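import Literature.MathematicalPhysics.QuantumFieldTheory.Balaban1983to89.B9PinCarriersKLevelV1
import Literature.MathematicalPhysics.QuantumFieldTheory.Balaban1983to89.B9BackgroundsKLevelV1P

/-!
# `Balaban1983to89.B9PinCarriersKLevelV1P` — Stage-3′(Y) GEOMETRY∕INDEX layer, MODULE 5-P: the [B9] carrier bundle `carriersYP ops : DagBinding.PrintedCarriers9X`
# over PRINT'S CUBE CLASS (backgrounds `bg9YP` of MODULE 2-P `B9BackgroundsKLevelV1P`) as a function of the SAME operator layer `OperatorLayerY` (MODULE 5), and
# the N06 knit at this bundle with every geometric hypothesis discharged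

B9 = T. Bałaban, *Propagators for lattice gauge theories in a background field*, Commun. Math. Phys. **99** (1985) 389–434 [Balaban1985BackgroundPropagators].
pub-ymgap Track A, node N06 = `Dag.B9_main`; seat `pub-ymgap-node00-def-Y` g7 (OWNER of the `OpsY` instance at the record).  APPEND-ONLY twin of MODULE 5
`B9PinCarriersKLevelV1` (untouched, consumed by name): the ONLY change is the background carrier `bg9 := bg9YP 𝔸 G` (print's class: sizes «O(1) ≧ 10» open-ended,
per-cube constant — MODULE 2-P) in place of `bg9Y 𝔸 G` (MODULE 2's Lean-side small-cube variant).  DEFINITIONS + knit theorems; nothing of [B9] asserted;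
count-neutral; N06 NOT discharged.

THE OPERATOR LAYER IS THE SAME TYPE.  `OperatorLayerY 𝔸 G x` (MODULE 5 §1) types its sixteen kernel ∕ expansion records over `bg9Y 𝔸 G x`; the six record
structures of `B9` (`KernelFamily`, `SiteKernel`, `FineKernel`, `RWExpansion`, `RWKernelExpansion`, `HKernel`) read a background carrier ONLY through its
configuration type `B.Cfg` (B9.lean :119, :201, :424, :646, :657, :1007), and `(bg9YP 𝔸 G x).Cfg = (bg9Y 𝔸 G x).Cfg` DEFINITIONALLY (`B9BackgroundsKLevelV1P.bg9YP_Cfg_eq`,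
`rfl`; likewise `one`, `mul`).  Hence §1 re-types each record FIELDWISE (`kernelFamilyP K := ⟨K.e, K.h1, K.e4, K.h2, K.l2, K.glob⟩`, …; inverses `kernelFamilyY`,
`hKernelY` for the record-taking predicates; all round trips `rfl`), and NODE 00's instance of record `opsYOfRecordV6E … : OpsY N θ M⋆ = ∀ x, OperatorLayerY … x`
plugs into `carriersYP` UNCHANGED — no operator is re-constructed, no kernel entry changes (`kernelFamilyP_e : (kernelFamilyP K).e = K.e := rfl`, …).

WHAT IS DEFINED ∕ PROVED.
* §1 the fieldwise re-typings `kernelFamilyP ∕ kernelFamilyY`, `siteKernelP`, `fineKernelP`, `rwExpansionP`, `rwKernelExpansionP`, `hKernelP ∕ hKernelY` with their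
  field lemmas and round trips (`rfl`).
* §2 **`carriersYP 𝔸 G ops : PrintedCarriers9X`** — `I9 := MemberY …`, `d9 := d + 1`, `c35 := c35Y (= 10 = print's «≧ 10» threshold)`, `geo9 := geo9Y`, **`bg9 := bg9YP 𝔸 G`**,
  `InCube := InCubeY`, `dOmega := dOmegaY`, `OmK := OmKY`, `inΛ := inΛY`, `unitDist := unitDistY`; the sixteen records of `ops x` re-typed by §1; the four
  record-taking predicates (`IsAnalyticExt`, `HasRWExp`, `HasRWExpH`, `PosDefK`) precomposed with the inverse re-typing; the three configuration predicates
  (`PosDef`, `GivenBy3185`, `HasRWExpC`) verbatim.  Field lemmas by `rfl`, incl. `carriersYP_I9_eq ∕ _geo9_eq ∕ _c35_eq` (= MODULE 5's bundle's).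
* §3 **THE KNIT AT `carriersYP`**: `b9LeafX_carriersYP` = `B9LeafKnitOn.b9LeafX_of_b6BlockParam_on` at `Y := carriersYP 𝔸 G ops`, NODE 00's tower block of record,
  `ι x := ⟨x.toKIdx, x.hcfk⟩`, `hd := rfl`, `hc := c35Y_pos`, **`hone := B9BackgroundsKLevelV1P.reg335YP_one`** (`U ≡ 1` is in print's class), `S := modelSignsOn_geo9K`,
  `Dict := dictAtOneY` (MODULE 4, generic in the background carrier).  DISPLAYED: the eight `U = 1` operator comparisons per member and the two null readings —
  VERBATIM MODULE 5's binders (they do not see the class; the certificate's existing proofs apply unchanged) —, the residual entries, the Sect. B step, the gauge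
  reduction and the sixteen leaves NOW OVER `bg9YP` (their `(bg9YP …).Reg335 c35Y α₀ U` is (3.35) over PRINT's class — the binder dag-n06-j's coverage theorem
  serves), and `B6BlockParam (towerBlockOfRecord …)`.
* §4 guards: `carriersYP_nonempty_I9`, `carriersYP_unbounded_M`, `carriersYP_exists_nonempty_Λ`, `carriersYP_cor36_vacuous` (MODULE 3's ∕ MODULE 4's facts, class-independent).
CONSUMERS (said on the pub-ymgap bus): node00-def-K0a — `Y9OfRecordP N θ M⋆ ops := carriersYP … ops` beside `Node00.CarriersY.Y9OfRecord` (same `OpsY` slot, same `pinY`);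
dag-n06-d — the certificate edition over `bg9YP` (U = 1 binders verbatim; leaf ∕ residual binders with `bg9Y ↦ bg9YP`, `(ops x).K ↦ kernelFamilyP (ops x).K`, …).
HONEST SCOPE: the operator layer is a PARAMETER; the class (3.35) is a HYPOTHESIS class; no estimate; one finite lattice programme; NOT continuum ∕ OS ∕ mass gap ∕
Clay.  No `sorry`, no `axiom`, no `instance`, no `notation`.
-/

noncomputable section

namespace Literature.MathematicalPhysics.QuantumFieldTheory.Balaban1983to89.B9PinCarriersKLevelV1P

open DagBinding
open B6KLevelCensusIndexV1 (KIdx)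
open B9PinMembersKLevelV1 (MemberY geo9Y bg9Y)
open B9BackgroundsKLevelV1P (bg9YP reg335YP_one)
open B9PinGeometryKLevelV1 (dOmegaY OmKY inΛY unitDistY InCubeY c35Y c35Y_pos dictAtOneY)
open B9PinCarriersKLevelV1 (OperatorLayerY carriersY)
open B9FromB6ModelSignsOn (ModelSignsOn)

variable {d ℓ : ℕ} {hd : 1 ≤ d + 1} {hL : Odd (ℓ + 1) ∧ 1 < ℓ + 1} {b₀ b₁ : ℝ} {Mstar : ℕ}
variable {𝔸 : Type} [NormedRing 𝔸] [NormedAlgebra ℂ 𝔸] [CompleteSpace 𝔸] {G : Subgroup 𝔸ˣ}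

/-! ## §1 Fieldwise re-typing of the operator layer's records over `bg9YP` (same configurations, same entries) -/

section Retype

variable {x : MemberY d ℓ hd hL b₀ b₁ Mstar}

/-- a kernel family over `bg9Y x` IS one over `bg9YP x` (same configuration type; entries copied). [cite: Balaban1985BackgroundPropagators, (3.42)–(3.47) pp.397–398 (bookkeeping)] -/
def kernelFamilyP (K : B9.KernelFamily (geo9Y x) (bg9Y 𝔸 G x)) : B9.KernelFamily (geo9Y x) (bg9YP 𝔸 G x) :=
  ⟨K.e, K.h1, K.e4, K.h2, K.l2, K.glob⟩

/-- … and conversely. [cite: Balaban1985BackgroundPropagators, (3.42)–(3.47) pp.397–398 (bookkeeping)] -/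
def kernelFamilyY (K : B9.KernelFamily (geo9Y x) (bg9YP 𝔸 G x)) : B9.KernelFamily (geo9Y x) (bg9Y 𝔸 G x) :=
  ⟨K.e, K.h1, K.e4, K.h2, K.l2, K.glob⟩

/-- round trip. [cite: Balaban1985BackgroundPropagators, p.397 (bookkeeping)] -/
theorem kernelFamilyY_kernelFamilyP (K : B9.KernelFamily (geo9Y x) (bg9Y 𝔸 G x)) : kernelFamilyY (kernelFamilyP K) = K := rfl
/-- round trip. [cite: Balaban1985BackgroundPropagators, p.397 (bookkeeping)] -/
theorem kernelFamilyP_kernelFamilyY (K : B9.KernelFamily (geo9Y x) (bg9YP 𝔸 G x)) : kernelFamilyP (kernelFamilyY K) = K := rfl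
/-- same entries (3.42). [cite: Balaban1985BackgroundPropagators, (3.42) p.397 (bookkeeping)] -/
theorem kernelFamilyP_e (K : B9.KernelFamily (geo9Y x) (bg9Y 𝔸 G x)) : (kernelFamilyP K).e = K.e := rfl
/-- same entries (3.43). [cite: Balaban1985BackgroundPropagators, (3.43) p.397 (bookkeeping)] -/
theorem kernelFamilyP_h1 (K : B9.KernelFamily (geo9Y x) (bg9Y 𝔸 G x)) : (kernelFamilyP K).h1 = K.h1 := rfl
/-- same entries (3.44). [cite: Balaban1985BackgroundPropagators, (3.44) p.398 (bookkeeping)] -/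
theorem kernelFamilyP_e4 (K : B9.KernelFamily (geo9Y x) (bg9Y 𝔸 G x)) : (kernelFamilyP K).e4 = K.e4 := rfl
/-- same entries (3.45). [cite: Balaban1985BackgroundPropagators, (3.45) p.398 (bookkeeping)] -/
theorem kernelFamilyP_h2 (K : B9.KernelFamily (geo9Y x) (bg9Y 𝔸 G x)) : (kernelFamilyP K).h2 = K.h2 := rfl
/-- same entries (3.46). [cite: Balaban1985BackgroundPropagators, (3.46) p.398 (bookkeeping)] -/
theorem kernelFamilyP_l2 (K : B9.KernelFamily (geo9Y x) (bg9Y 𝔸 G x)) : (kernelFamilyP K).l2 = K.l2 := rfl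
/-- same entries (3.47). [cite: Balaban1985BackgroundPropagators, (3.47) p.398 (bookkeeping)] -/
theorem kernelFamilyP_glob (K : B9.KernelFamily (geo9Y x) (bg9Y 𝔸 G x)) : (kernelFamilyP K).glob = K.glob := rfl

/-- a site kernel over `bg9Y x` IS one over `bg9YP x`. [cite: Balaban1985BackgroundPropagators, (3.48) p.398 (bookkeeping)] -/
def siteKernelP (C : B9.SiteKernel (geo9Y x) (bg9Y 𝔸 G x)) : B9.SiteKernel (geo9Y x) (bg9YP 𝔸 G x) :=
  ⟨C.ker⟩

/-- same kernel. [cite: Balaban1985BackgroundPropagators, (3.48) p.398 (bookkeeping)] -/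
theorem siteKernelP_ker (C : B9.SiteKernel (geo9Y x) (bg9Y 𝔸 G x)) : (siteKernelP C).ker = C.ker := rfl

/-- a fine kernel over `bg9Y x` IS one over `bg9YP x`. [cite: Balaban1985BackgroundPropagators, (3.49) p.399 (bookkeeping)] -/
def fineKernelP (P : B9.FineKernel (geo9Y x) (bg9Y 𝔸 G x)) : B9.FineKernel (geo9Y x) (bg9YP 𝔸 G x) :=
  ⟨P.ker⟩

/-- same kernel. [cite: Balaban1985BackgroundPropagators, (3.49) p.399 (bookkeeping)] -/
theorem fineKernelP_ker (P : B9.FineKernel (geo9Y x) (bg9Y 𝔸 G x)) : (fineKernelP P).ker = P.ker := rfl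

/-- a random-walk expansion over `bg9Y x` IS one over `bg9YP x`. [cite: Balaban1985BackgroundPropagators, (3.90) p.409 (bookkeeping)] -/
def rwExpansionP (E : B9.RWExpansion (geo9Y x) (bg9Y 𝔸 G x)) : B9.RWExpansion (geo9Y x) (bg9YP 𝔸 G x) :=
  ⟨E.Walk, E.wlen, E.first, E.last, E.wdist, E.term, E.LocDep, E.Converges⟩

/-- same walk terms. [cite: Balaban1985BackgroundPropagators, (3.90) p.409 (bookkeeping)] -/
theorem rwExpansionP_term (E : B9.RWExpansion (geo9Y x) (bg9Y 𝔸 G x)) : (rwExpansionP E).term = E.term := rfl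

/-- a random-walk kernel expansion over `bg9Y x` IS one over `bg9YP x`. [cite: Balaban1985BackgroundPropagators, (3.98)–(3.99) p.412 (bookkeeping)] -/
def rwKernelExpansionP (E : B9.RWKernelExpansion (geo9Y x) (bg9Y 𝔸 G x)) : B9.RWKernelExpansion (geo9Y x) (bg9YP 𝔸 G x) :=
  ⟨E.Walk, E.wlen, E.wdist, E.kterm, E.LocDep, E.Converges⟩

/-- same walk terms. [cite: Balaban1985BackgroundPropagators, (3.98)–(3.99) p.412 (bookkeeping)] -/
theorem rwKernelExpansionP_kterm (E : B9.RWKernelExpansion (geo9Y x) (bg9Y 𝔸 G x)) : (rwKernelExpansionP E).kterm = E.kterm := rfl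

/-- an `H`-kernel over `bg9Y x` IS one over `bg9YP x`. [cite: Balaban1985BackgroundPropagators, (3.133) p.422 (bookkeeping)] -/
def hKernelP (H : B9.HKernel (geo9Y x) (bg9Y 𝔸 G x)) : B9.HKernel (geo9Y x) (bg9YP 𝔸 G x) :=
  ⟨H.e, H.h⟩

/-- … and conversely. [cite: Balaban1985BackgroundPropagators, (3.133) p.422 (bookkeeping)] -/
def hKernelY (H : B9.HKernel (geo9Y x) (bg9YP 𝔸 G x)) : B9.HKernel (geo9Y x) (bg9Y 𝔸 G x) :=
  ⟨H.e, H.h⟩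

/-- round trip. [cite: Balaban1985BackgroundPropagators, p.422 (bookkeeping)] -/
theorem hKernelY_hKernelP (H : B9.HKernel (geo9Y x) (bg9Y 𝔸 G x)) : hKernelY (hKernelP H) = H := rfl
/-- round trip. [cite: Balaban1985BackgroundPropagators, p.422 (bookkeeping)] -/
theorem hKernelP_hKernelY (H : B9.HKernel (geo9Y x) (bg9YP 𝔸 G x)) : hKernelP (hKernelY H) = H := rfl
/-- same entries. [cite: Balaban1985BackgroundPropagators, (3.133) p.422 (bookkeeping)] -/
theorem hKernelP_e (H : B9.HKernel (geo9Y x) (bg9Y 𝔸 G x)) : (hKernelP H).e = H.e := rfl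
/-- same entries. [cite: Balaban1985BackgroundPropagators, (3.133) p.422 (bookkeeping)] -/
theorem hKernelP_h (H : B9.HKernel (geo9Y x) (bg9Y 𝔸 G x)) : (hKernelP H).h = H.h := rfl

end Retype

/-! ## §2 The carrier bundle over print's class as a function of the operator layer -/

variable (d ℓ hd hL b₀ b₁ Mstar 𝔸 G)

/-- **THE [B9] CARRIER BUNDLE OF STAGE 3′(Y) OVER PRINT'S CUBE CLASS, AS A FUNCTION OF THE OPERATOR LAYER**: MODULE 5's `carriersY` with `bg9 := bg9YP 𝔸 G`
(MODULE 2-P: «O(1) ≧ 10» open-ended, per-cube constant), the operator records re-typed fieldwise (§1), everything else verbatim.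
[cite: Balaban1985BackgroundPropagators, p.396 («a number ≧ 10», (3.35)), Thms 3.1–3.15 pp.397–432 (the carriers of the typed statements)] -/
def carriersYP (ops : ∀ x : MemberY d ℓ hd hL b₀ b₁ Mstar, OperatorLayerY d ℓ hd hL b₀ b₁ Mstar 𝔸 G x) : PrintedCarriers9X where
  I9 := MemberY d ℓ hd hL b₀ b₁ Mstar
  d9 := d + 1
  c35 := c35Y
  geo9 := geo9Y
  bg9 := bg9YP 𝔸 G
  InCube := InCubeY
  Gp := fun x => kernelFamilyP (ops x).Gp
  GA := fun x => kernelFamilyP (ops x).GA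
  Cinv := fun x => siteKernelP (ops x).Cinv
  IsAnalyticExt := fun x K => (ops x).IsAnalyticExt (kernelFamilyY K)
  E37 := fun x => rwExpansionP (ops x).E37
  EK39 := fun x => rwKernelExpansionP (ops x).EK39
  E310 := fun x => rwExpansionP (ops x).E310
  PosDef := fun x => (ops x).PosDef
  GD := fun x => kernelFamilyP (ops x).GD
  G₁ := fun x => kernelFamilyP (ops x).G₁
  H := fun x => hKernelP (ops x).H
  H₁ := fun x => hKernelP (ops x).H₁
  HasRWExp := fun x K => (ops x).HasRWExp (kernelFamilyY K)
  HasRWExpH := fun x K => (ops x).HasRWExpH (hKernelY K)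
  PosDefK := fun x K => (ops x).PosDefK (kernelFamilyY K)
  GG := fun x => kernelFamilyP (ops x).GG
  Kdiff := fun x => kernelFamilyP (ops x).Kdiff
  dOmega := dOmegaY
  Ck := fun x => siteKernelP (ops x).Ck
  inΛ := inΛY
  unitDist := unitDistY
  GivenBy3185 := fun x => (ops x).GivenBy3185
  HasRWExpC := fun x => (ops x).HasRWExpC
  P349 := fun x => fineKernelP (ops x).P349
  QGQinv := fun x => siteKernelP (ops x).QGQinv
  QG1Qinv := fun x => siteKernelP (ops x).QG1Qinv
  OmK := OmKY

variable {d ℓ hd hL b₀ b₁ Mstar 𝔸 G}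
variable (ops : ∀ x : MemberY d ℓ hd hL b₀ b₁ Mstar, OperatorLayerY d ℓ hd hL b₀ b₁ Mstar 𝔸 G x)

/-- the index of the bundle is the member type. [cite: Balaban1985BackgroundPropagators, p.399 (bookkeeping)] -/
theorem carriersYP_I9 : (carriersYP d ℓ hd hL b₀ b₁ Mstar 𝔸 G ops).I9 = MemberY d ℓ hd hL b₀ b₁ Mstar := rfl
/-- … the same as MODULE 5's bundle's. [cite: Balaban1985BackgroundPropagators, p.399 (bookkeeping)] -/
theorem carriersYP_I9_eq : (carriersYP d ℓ hd hL b₀ b₁ Mstar 𝔸 G ops).I9 = (carriersY d ℓ hd hL b₀ b₁ Mstar 𝔸 G ops).I9 := rfl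
/-- the geometry of the bundle is `geo9Y`. [cite: Balaban1985BackgroundPropagators, Sect. A pp.396–397 (bookkeeping)] -/
theorem carriersYP_geo9 : (carriersYP d ℓ hd hL b₀ b₁ Mstar 𝔸 G ops).geo9 = geo9Y := rfl
/-- … the same as MODULE 5's bundle's. [cite: Balaban1985BackgroundPropagators, Sect. A pp.396–397 (bookkeeping)] -/
theorem carriersYP_geo9_eq : (carriersYP d ℓ hd hL b₀ b₁ Mstar 𝔸 G ops).geo9 = (carriersY d ℓ hd hL b₀ b₁ Mstar 𝔸 G ops).geo9 := rfl
/-- **the backgrounds of the bundle are `bg9YP`** (print's class). [cite: Balaban1985BackgroundPropagators, (3.35)–(3.38) p.396 («≧ 10»)] -/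
theorem carriersYP_bg9 : (carriersYP d ℓ hd hL b₀ b₁ Mstar 𝔸 G ops).bg9 = bg9YP 𝔸 G := rfl
/-- the threshold of (3.35) at the bundle is `10` = print's «a number ≧ 10». [cite: Balaban1985BackgroundPropagators, p.396 («≧ 10»)] -/
theorem carriersYP_c35 : (carriersYP d ℓ hd hL b₀ b₁ Mstar 𝔸 G ops).c35 = 10 := rfl
/-- … the same as MODULE 5's bundle's. [cite: Balaban1985BackgroundPropagators, p.396 (bookkeeping)] -/
theorem carriersYP_c35_eq : (carriersYP d ℓ hd hL b₀ b₁ Mstar 𝔸 G ops).c35 = (carriersY d ℓ hd hL b₀ b₁ Mstar 𝔸 G ops).c35 := rfl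
/-- (3.154) at the bundle is `dOmegaY`. [cite: Balaban1985BackgroundPropagators, (3.154) p.427 (bookkeeping)] -/
theorem carriersYP_dOmega : (carriersYP d ℓ hd hL b₀ b₁ Mstar 𝔸 G ops).dOmega = dOmegaY := rfl
/-- Cor. 3.6's cube predicate at the bundle is `InCubeY`. [cite: Balaban1985BackgroundPropagators, Cor. 3.6 p.408 (bookkeeping)] -/
theorem carriersYP_InCube : (carriersYP d ℓ hd hL b₀ b₁ Mstar 𝔸 G ops).InCube = InCubeY := rfl
/-- the kernel entries of `G′` at the bundle are the operator layer's (re-typed, same values). [cite: Balaban1985BackgroundPropagators, (3.42) p.397 (bookkeeping)] -/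
theorem carriersYP_Gp_e (x : MemberY d ℓ hd hL b₀ b₁ Mstar) : ((carriersYP d ℓ hd hL b₀ b₁ Mstar 𝔸 G ops).Gp x).e = (ops x).Gp.e := rfl
/-- the kernel entries of `G` at the bundle are the operator layer's. [cite: Balaban1985BackgroundPropagators, (3.42) p.397 (bookkeeping)] -/
theorem carriersYP_GA_e (x : MemberY d ℓ hd hL b₀ b₁ Mstar) : ((carriersYP d ℓ hd hL b₀ b₁ Mstar 𝔸 G ops).GA x).e = (ops x).GA.e := rfl
/-- the kernel of `(Q′G′²Q′*)⁻¹` at the bundle is the operator layer's. [cite: Balaban1985BackgroundPropagators, (3.48) p.398 (bookkeeping)] -/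
theorem carriersYP_Cinv_ker (x : MemberY d ℓ hd hL b₀ b₁ Mstar) : ((carriersYP d ℓ hd hL b₀ b₁ Mstar 𝔸 G ops).Cinv x).ker = (ops x).Cinv.ker := rfl

/-! ## §3 The N06 knit at the bundle over print's class: geometric hypotheses discharged -/

section Knit

variable [NormOneClass 𝔸]

/-- **`B6BlockParam (towerBlockOfRecord …) → B9LeafX (carriersYP … ops)` — the N06 knit AT THE STAGE-3′(Y) BUNDLE OVER PRINT'S CUBE CLASS with every geometric
input discharged** (`hd := rfl`, `hc := c35Y_pos`, `hone := reg335YP_one` (MODULE 2-P: `U ≡ 1` is in print's class), `S :=` dag-n03-b's `modelSignsOn_geo9K`,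
`Dict := dictAtOneY`).  Displayed: the `U = 1` operator comparisons against NODE 00's readings (eight per member) and the two null readings — VERBATIM MODULE 5's —,
the residual entries, the Sect. B step, the gauge reduction, the sixteen whole-statement leaves OVER `bg9YP` (their (3.35) is over print's class), the [B6] block.
[cite: Balaban1985BackgroundPropagators, Thms 3.1–3.15 pp.397–432; Cor. 3.5 proof p.407; p.396 («≧ 10»)] -/
theorem b9LeafX_carriersYP (δ₀ : ℝ) {Jt Kt : Type} (tree : Jt → B6.TreeData) (loc : Kt → B6.LocalOp)
    (hGp_e : ∀ (x : MemberY d ℓ hd hL b₀ b₁ Mstar) (n : Fin 4) (lam : (geo9Y x).Loc) (y : (geo9Y x).Site),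
      (ops x).Gp.e n (bg9Y 𝔸 G x).one lam y ≤ (Node00.GpU x.toKIdx).e n lam y)
    (hGp_h1 : ∀ (x : MemberY d ℓ hd hL b₀ b₁ Mstar) (lam : (geo9Y x).Loc) (b : ℝ) (ζ : (geo9Y x).Cut),
      (ops x).Gp.h1 (bg9Y 𝔸 G x).one lam b ζ ≤ (Node00.GpU x.toKIdx).h1 lam b ζ)
    (hC : ∀ (x : MemberY d ℓ hd hL b₀ b₁ Mstar) (y y' : (geo9Y x).Site), |(ops x).Cinv.ker (bg9Y 𝔸 G x).one y y'| ≤ |(Node00.CinvU x.toKIdx).ker y y'|)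
    (hGA_e : ∀ (x : MemberY d ℓ hd hL b₀ b₁ Mstar) (n : Fin 4) (lam : (geo9Y x).Loc) (y : (geo9Y x).Site),
      (ops x).GA.e n (bg9Y 𝔸 G x).one lam y ≤ (Node00.GU x.toKIdx).e n lam y)
    (hGA_h1 : ∀ (x : MemberY d ℓ hd hL b₀ b₁ Mstar) (lam : (geo9Y x).Loc) (b : ℝ) (ζ : (geo9Y x).Cut),
      (ops x).GA.h1 (bg9Y 𝔸 G x).one lam b ζ ≤ (Node00.GU x.toKIdx).h1 lam b ζ)
    (hGA_e4 : ∀ (x : MemberY d ℓ hd hL b₀ b₁ Mstar) (lam : (geo9Y x).Loc) (y : (geo9Y x).Site),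
      (ops x).GA.e4 (bg9Y 𝔸 G x).one lam y ≤ (Node00.GU x.toKIdx).e4 lam y)
    (hGA_h2 : ∀ (x : MemberY d ℓ hd hL b₀ b₁ Mstar) (lam : (geo9Y x).Loc) (b : ℝ) (ζ : (geo9Y x).Cut),
      (ops x).GA.h2 (bg9Y 𝔸 G x).one lam b ζ ≤ (Node00.GU x.toKIdx).h2 lam b ζ)
    (hGA_l2 : ∀ (x : MemberY d ℓ hd hL b₀ b₁ Mstar) (n : Fin 6) (lam : (geo9Y x).Loc) (h : (geo9Y x).Cut),
      (ops x).GA.l2 n (bg9Y 𝔸 G x).one lam h ≤ (Node00.GU x.toKIdx).l2 n lam h)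
    (hE4 : ∀ (x : MemberY d ℓ hd hL b₀ b₁ Mstar) (lam : (geo9Y x).Loc), ¬ (lam.isRight = true) → ∀ y, (ops x).GA.e4 (bg9Y 𝔸 G x).one lam y ≤ 0)
    (hH2 : ∀ (x : MemberY d ℓ hd hL b₀ b₁ Mstar) (lam : (geo9Y x).Loc), ¬ (lam.isRight = true) →
      ∀ (β : ℝ) (ζ : (geo9Y x).Cut), (ops x).GA.h2 (bg9Y 𝔸 G x).one lam β ζ ≤ 0)
    (hGp : B9FromB6.ResidualGpAtOne geo9Y (bg9YP 𝔸 G) (fun x => kernelFamilyP (ops x).Gp))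
    (hGA : B9FromB6.ResidualGAGlobAtOne geo9Y (bg9YP 𝔸 G) (fun x => kernelFamilyP (ops x).GA))
    (hB : B9.SectBStepPrinted (d + 1) c35Y geo9Y (bg9YP 𝔸 G) (fun x => kernelFamilyP (ops x).Gp) (fun x => kernelFamilyP (ops x).GA)
      (fun x => siteKernelP (ops x).Cinv) (fun x K => (ops x).IsAnalyticExt (kernelFamilyY K)))
    (hg : B9.GaugeReduction335 (d + 1) c35Y geo9Y (bg9YP 𝔸 G) InCubeY (fun x => kernelFamilyP (ops x).Gp) (fun x => kernelFamilyP (ops x).GA)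
      (fun x => siteKernelP (ops x).Cinv))
    (t37 : B9.Thm37Printed c35Y geo9Y (bg9YP 𝔸 G) (fun x => rwExpansionP (ops x).E37))
    (c38 : B9.Cor38Printed c35Y geo9Y (bg9YP 𝔸 G) (fun x => rwExpansionP (ops x).E37))
    (t39 : B9.Thm39Printed (d + 1) c35Y geo9Y (bg9YP 𝔸 G) (fun x => rwKernelExpansionP (ops x).EK39))
    (t310 : B9.Thm310Printed c35Y geo9Y (bg9YP 𝔸 G) (fun x => rwExpansionP (ops x).E310))
    (hsum : B9.RWSumsYieldIneqs geo9Y (bg9YP 𝔸 G) (fun x => rwExpansionP (ops x).E37) (fun x => rwExpansionP (ops x).E310)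
      (fun x => kernelFamilyP (ops x).Gp) (fun x => kernelFamilyP (ops x).GA))
    (hksum : B9.RWKernelSumYields (d + 1) geo9Y (bg9YP 𝔸 G) (fun x => rwKernelExpansionP (ops x).EK39) (fun x => siteKernelP (ops x).Cinv))
    (t311 : B9.Thm311Printed c35Y geo9Y (bg9YP 𝔸 G) (fun x => (ops x).PosDef))
    (t312 : B9.Thm312Printed (d + 1) c35Y geo9Y (bg9YP 𝔸 G) (fun x => kernelFamilyP (ops x).GD) (fun x => kernelFamilyP (ops x).G₁)
      (fun x => hKernelP (ops x).H) (fun x => hKernelP (ops x).H₁) (fun x K => (ops x).HasRWExp (kernelFamilyY K))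
      (fun x K => (ops x).HasRWExpH (hKernelY K)) (fun x K => (ops x).PosDefK (kernelFamilyY K)))
    (t313 : B9.Thm313Printed c35Y geo9Y (bg9YP 𝔸 G) (fun x => kernelFamilyP (ops x).GG) (fun x K => (ops x).HasRWExp (kernelFamilyY K))
      (fun x K => (ops x).PosDefK (kernelFamilyY K)))
    (t314 : B9.Thm314Printed c35Y geo9Y (bg9YP 𝔸 G) (fun x => kernelFamilyP (ops x).Kdiff) dOmegaY)
    (t315 : B9.Thm315FullPrinted c35Y geo9Y (bg9YP 𝔸 G) (fun x => siteKernelP (ops x).Ck) inΛY unitDistY (fun x => (ops x).GivenBy3185)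
      (fun x => (ops x).HasRWExpC))
    (s349 : B9.Stmt349Printed (d + 1) c35Y geo9Y (bg9YP 𝔸 G) (fun x => fineKernelP (ops x).P349))
    (s3132 : B9.Stmt3132Printed (d + 1) c35Y geo9Y (bg9YP 𝔸 G) (fun x => siteKernelP (ops x).QGQinv) (fun x => siteKernelP (ops x).QG1Qinv))
    (t314loc : B9Thm314.Thm314LocalPrinted c35Y geo9Y (bg9YP 𝔸 G) (fun x => kernelFamilyP (ops x).Kdiff) OmKY dOmegaY)
    (h6 : B6BlockParam (Node00.towerBlockOfRecord d ℓ hd hL b₀ b₁ δ₀ tree loc)) :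
    B9LeafX (carriersYP d ℓ hd hL b₀ b₁ Mstar 𝔸 G ops) :=
  B9LeafKnitOn.b9LeafX_of_b6BlockParam_on (carriersYP d ℓ hd hL b₀ b₁ Mstar 𝔸 G ops) (Node00.towerBlockOfRecord d ℓ hd hL b₀ b₁ δ₀ tree loc) rfl
    (fun x => ⟨x.toKIdx, x.hcfk⟩)
    (fun x => dictAtOneY x (kernelFamilyP (ops x).Gp) (kernelFamilyP (ops x).GA) (siteKernelP (ops x).Cinv) (hGp_e x) (hGp_h1 x) (hC x) (hGA_e x)
      (hGA_h1 x) (hGA_e4 x) (hGA_h2 x) (hGA_l2 x))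
    (fun _ => fun lam => lam.isRight = true) (fun x => B9GeoNormsKLevelModelSignsV1.modelSignsOn_geo9K x.toKIdx) hE4 hH2 hGp hGA c35Y_pos
    (fun x _ hα => reg335YP_one x c35Y hα) hB hg t37 c38 t39 t310 hsum hksum t311 t312 t313 t314 t315 s349 s3132 t314loc h6

end Knit

/-! ## §4 Guards at the bundle -/

/-- the bundle's index is inhabited (odd `L ≥ 5`, band `0 < b₀ ≤ b₁`). [cite: Balaban1985BackgroundPropagators, p.399 (the family is inhabited)] -/
theorem carriersYP_nonempty_I9 (hℓ : 4 ≤ ℓ) (hb₀ : 0 < b₀) (hb₁ : b₀ ≤ b₁) : Nonempty (carriersYP d ℓ hd hL b₀ b₁ Mstar 𝔸 G ops).I9 :=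
  B9PinMembersKLevelV1.memberY_nonempty hℓ hb₀ hb₁

/-- `M` is unbounded over the bundle's index. [cite: Balaban1985BackgroundPropagators, Thm 3.1 p.397 («for M ≥ M₁»)] -/
theorem carriersYP_unbounded_M (hℓ : 4 ≤ ℓ) (hb₀ : 0 < b₀) (hb₁ : b₀ ≤ b₁) (M₂ : ℝ) :
    ∃ i : (carriersYP d ℓ hd hL b₀ b₁ Mstar 𝔸 G ops).I9, M₂ ≤ ((carriersYP d ℓ hd hL b₀ b₁ Mstar 𝔸 G ops).geo9 i).M :=
  B9PinMembersKLevelV1.memberY_unbounded_M hℓ hb₀ hb₁ M₂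

/-- at `L = 5` the bundle has members with non-empty `Λ`. [cite: Balaban1985BackgroundPropagators, Thm 3.15 p.432 (non-vacuity of the typed datum)] -/
theorem carriersYP_exists_nonempty_Λ (hℓ : 4 ≤ ℓ) (hℓ4 : ℓ ≤ 4) {k : ℕ} (hk : 2 ≤ k) (hb₀ : 0 < b₀) (hb₁ : b₀ ≤ b₁) (M₂ : ℝ) :
    ∃ i : (carriersYP d ℓ hd hL b₀ b₁ Mstar 𝔸 G ops).I9, i.k = k ∧ M₂ ≤ ((carriersYP d ℓ hd hL b₀ b₁ Mstar 𝔸 G ops).geo9 i).M ∧ i.Λ.Nonempty :=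
  B9PinMembersKLevelV1.memberY_exists_nonempty_Λ hℓ hℓ4 hk hb₀ hb₁ M₂

/-- Cor. 3.6 at the bundle is VACUOUS (MODULE 4's located fact `not_inCubeY`), for any operator layer and over print's class too.
[cite: Balaban1985BackgroundPropagators, Cor. 3.6 p.408 (bookkeeping: vacuity at these carriers)] -/
theorem carriersYP_cor36_vacuous :
    B9.Cor36Printed (d + 1) c35Y geo9Y (bg9YP 𝔸 G) InCubeY (fun x => kernelFamilyP (ops x).Gp) (fun x => kernelFamilyP (ops x).GA)
      (fun x => siteKernelP (ops x).Cinv) :=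
  B9PinGeometryKLevelV1.cor36Printed_vacuous (d + 1) c35Y (bg9YP 𝔸 G) _ _ _

end Literature.MathematicalPhysics.QuantumFieldTheory.Balaban1983to89.B9PinCarriersKLevelV1P

end
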